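import Summits.BirchSwinnertonDyer.Rank1Residual.X12.SexticTwistFamily
import HarnessLib

/-!
# X12, `p = 3`, Kriz–Li corner: the SIX remaining window classes as instances of the family theorem

HONEST FRAMING (cell `b2b-bsdres`, run/shared/lean/b2b/bsd-rank1-residual/; X12 prover owner
`b2b-bsdres-x1b`, gen 18): the goal is to DELETE the COMBINATION-SHAPED residual classes for ALL
analytic-rank `≤ 1` curves over `ℚ` — "full BSD formula for every rank `≤ 1` curve in class `C`"
assembled STRICTLY from published theorems — so that the rank-`≤ 1` remainder becomes exactly the
CONSTRUCTION-SHAPED classes, which are TYPED (missing-input Props), NOT attempted; this is not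
"finishing BSD". Class X12 (CM, `r = 1`, `p ∣ 6·d_K·N`, `p` not split) stays CONSTRUCTION-SHAPED;
the Kriz–Li sextic-twist corner at `p = 3` is FAMILY-shaped and this file is PER CLASS. THEOREMS
ONLY: no definition, NO new named fact (net Literature debt `0`); nothing is booked here (the lane
books, the referees rule).

Gen 17 landed the family theorem `SexticTwistFamily.bsdp_three_sexticTwist_family` (p235563):
`BSD(E_d, 3)` over `ℚ` for EVERY admissible `d` from PUBLISHED facts (Kriz–Li 2019 Thm. 10.10 /
Cor. 10.7 / Thm. 9.4, Gross–Zagier, Kolyvagin, `K`-rationality of Heegner points, Burungale–Flach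
2024 Cor. 2, modularity, Cassels) with ONE per-curve datum (Manin, Kriz–Li's hypothesis (4)), and
instantiated it on the class `225a` (`bsdp_three_cremona225a_of_family`). This file does the same for
the other six window classes of the cell's RESIDUAL-CASES record (d22; referee A R163.3, writer v27):

| class | `d` | `E_d =` Cremona `…2` | `N` | (1) | (2) `d mod 9` | (3a) `h₃` | kernel theorem |
|---|---|---|---|---|---|---|---|
| 1323m | `−7` | `[0,0,1,0,47]` | `1323 = 3³·7²` | `−7 ≡ 1 (4)` prime | `2` | `h(−7) = 1` | `threeClassNumberTrivial_neg7` |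
| 1728a | `8` | `[0,0,0,0,−54]` | `1728 = 2⁶·3³` | `8 = 4·2` | `8` | `h(−24) = 2` | `…_neg24` |
| 3888t | `12` | `[0,0,0,0,−81]` | `3888 = 2⁴·3⁵` | `12 = 4·3` | `3` | `h(−4) = 1` (`−36`) | `…_neg36` |
| 7803b | `17` | `[0,0,1,0,−115]` | `7803 = 3³·17²` | prime | `8` | `h(−51) = 2` | `…_neg51` |
| 11907s | `21` | `[0,0,1,0,−142]` | `11907 = 3⁵·7²` | `3·7` | `3` | `h(−7) = 1` (`−63`) | `…_neg63` |
| 15129a | `41` | `[0,0,1,0,−277]` | `15129 = 3²·41²` | prime | `5` | `h(−123) = 2` | `…_neg123` |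

so that the harvest-2 records `X12SexticTwist.bsdp_three_cremona<cls>_of_cor107` (p194760), which
carry THREE per-pair data binders (`hDt` Manin, `hN` conductor, `htam` the Tamagawa side condition
(i)) and a hand-picked Heegner field, are re-derived with `htam` DISCHARGED (eisenstein-p2's theorem
`X2.padicValNat_tamagawaProduct_twist_of_heegner_of_odd`, inside the family theorem) and the field
supplied by Kriz–Li Thm. 9.4: **per class the only data are a level-`N` parametrisation of `…2 ≅ E_d`
with Manin constant prime to `3` (`hDt`; Cremona `opt_man`: `c = 1` for both members of each class,
Agashe–Ribet–Stein–Cremona 2006 Thm. 2.6/5.2 for the optimal member) and `N(…2) = N` (`hN`,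
Cremona's table).** The identification `…2 ≅ E_d`, the `3`-isogeny `…1 ~ …2`, the `IsElliptic` /
`IsGloballyMinimal` instances and Kriz–Li's (1), (2), (3a) are kernel facts (harvest-2's
`X12SexticTwistTransport`, harvest-1's `KrizLi2019/ThreeClassNumbers`). `§1` packages the class
record once (`record_of_family`); `§2` instantiates it six times.

## References
* [KrizLi2019] D. Kriz, C. Li, Forum Math. Sigma 7 (2019) e15, Thm. 1.23 = Thm. 10.10, Cor. 10.7 (2), Thm. 9.4.
* [BurungaleFlach2024] Camb. J. Math. 12 (2024), Cor. 2. [Cassels1965ArithmeticVIII]; [MilneADT2006] Thm. I.7.3.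
* [Cremona1997] J. E. Cremona, *Algorithms for Modular Elliptic Curves*, Table 1 and `ecdata/allcurves`,
  `allisog`, `opt_man` (classes 1323m, 1728a, 3888t, 7803b, 11907s, 15129a).
* [AgasheRibetStein2006] PAMQ 2 (2006), Thm. 2.6 and Cremona's appendix Thm. 5.2 (Manin constants).
* [Cox2013] §2.A Thm. 2.13, §7.B Thm. 7.7(ii) (class numbers). [Miller2011LMS] Def. 1.1 (`BSD(E, p)`).
* HOME/b2b-bsdres-x1b/X12-ROUTE.md §21–§22; lane offer `bsdN/sweep/v5/x12fam3/` (rows `T-KL19ST3`).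
-/

set_option autoImplicit false

noncomputable section

open scoped Classical NumberField

open WeierstrassCurve NumberField Literature.NumberTheory.EllipticCurves
  Literature.NumberTheory.EllipticCurves.ModularForms
  Literature.NumberTheory.EllipticCurves.KrizLi2019
  Literature.NumberTheory.EllipticCurves.Rank1Residual
  Literature.NumberTheory.EllipticCurves.Rank1Residual.X12SexticTwist

namespace Summit.BirchSwinnertonDyer.Rank1Residual.X12.SexticTwistFamily

/-! ### §1. The class record, packaged once -/

/-- **Class record from the family theorem (Cor. 10.7 case (2)).** For `W ≅_ℚ E_d` globally minimal
of conductor `N`, `d` fundamental with `d ≡ 2,3,5,8 (mod 9)`, (3a), Corollary 10.7's case (2)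
(`d < 0, d ≡ 2` or `d > 0, d ≡ 3, 5, 8 (mod 9)`), a level-`N` parametrisation with `3 ∤ c`, and a
curve `W₁` `ℚ`-isogenous to `W`: `BSD(W, 3)`, `Ш(W/ℚ)` finite, `r_an(W) = rank W(ℚ) = 1`, and
`BSD(W₁, 3)`, `r_an(W₁) = 1` (Cassels). All named facts are PUBLISHED and taken as hypotheses
(`bsdp_three_sexticTwist_family`, `bsdp_three_of_isIsogenous_sexticTwist_family`).
[cite: KrizLi2019, Thm. 1.23 = Thm. 10.10, Cor. 10.7 (2), Thm. 9.4] [cite: MilneADT2006, Thm I.7.3] -/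
theorem record_of_family
    (h : thm1010_bsdThree_overK_sexticTwist) (h107 : cor107_analyticRank_sexticTwist)
    (h94 : thm94_exists_heegnerField_h3_eq_one)
    (hGZ : ∀ (N : ℕ) [NeZero N] (W : WeierstrassCurve ℚ) (K : Type) [Field K] [NumberField K],
      gross_zagier N W K)
    (hKo : ∀ (N : ℕ) [NeZero N] (W : WeierstrassCurve ℚ) (K : Type) [Field K] [NumberField K],
      kolyvagin N W K)
    (hrat : ∀ (N : ℕ) [NeZero N] (W : WeierstrassCurve ℚ) (K : Type) [Field K] [NumberField K],
      heegnerPointComplex_mem_range_map N W K)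
    (hCM0 : bsdTriple_of_hasCM_of_L_one_ne_zero) (hmod : hasEntireLFunction_rat)
    (hCassels : bsdRHS_eq_of_isIsogenous)
    (d : ℤ) (W : WeierstrassCurve ℚ) [W.IsElliptic] [W.IsGloballyMinimal] (N : ℕ) [NeZero N]
    (hW : ∃ C : VariableChange ℚ, C • W = ({ a₁ := 0, a₂ := 0, a₃ := 0, a₄ := 0, a₆ := -432 * d } :
      WeierstrassCurve ℚ))
    (hN : W.conductorNorm ℤ = N)
    (h1 : (d % 4 = 1 ∧ Squarefree d ∧ d ≠ 1) ∨
      (4 ∣ d ∧ (d / 4 % 4 = 2 ∨ d / 4 % 4 = 3) ∧ Squarefree (d / 4)))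
    (h9 : d % 9 = 2 ∨ d % 9 = 3 ∨ d % 9 = 5 ∨ d % 9 = 8)
    (h3a : (0 < d → ThreeClassNumberTrivial (-3 * d)) ∧ (d < 0 → ThreeClassNumberTrivial d))
    (hcase : d < 0 ∧ d % 9 = 2 ∨ 0 < d ∧ (d % 9 = 3 ∨ d % 9 = 5 ∨ d % 9 = 8))
    (hDt : ∃ Dt : ModularParametrizationData W N, ¬ (3 : ℤ) ∣ Dt.c)
    (W₁ : WeierstrassCurve ℚ) [W₁.IsElliptic] [W₁.IsGloballyMinimal] (hiso : IsIsogenous W₁ W) :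
    (BSDp W 3 ∧ W.ShaFinite ∧ W.analyticRank = 1 ∧ W.mordellWeilRank = 1) ∧
      (BSDp W₁ 3 ∧ W₁.analyticRank = 1) := by
  obtain ⟨Dt, h4⟩ := hDt
  obtain ⟨hbsd, hsha, hrk, hiff⟩ := bsdp_three_sexticTwist_family h h107 h94 hGZ hKo hrat hCM0 hmod
    d W N hW hN h1 h9 h3a Dt h4
  obtain ⟨hbsd1, hiff1⟩ := bsdp_three_of_isIsogenous_sexticTwist_family h h107 h94 hGZ hKo hrat
    hCM0 hmod hCassels d W N hW hN h1 h9 h3a Dt h4 W₁ hiso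
  have hr : W.analyticRank = 1 := hiff.mpr hcase
  exact ⟨⟨hbsd, hsha, hr, by rw [hrk, hr]⟩, hbsd1, hiff1.mpr hcase⟩

/-! ### §2. The six window classes -/

/-- **`1323m` (`d = −7`)**: `1323m2 = [0,0,1,0,47] ≅ E_{−7} : y² = x³ + 3024`, `1323m1 ~ 1323m2`
(`3`-isogeny). Per-pair inputs: `hDt` (a level-`1323` parametrisation of `1323m2` with Manin constant
prime to `3`) and `hN : N(1323m2) = 1323`. `−7 ≡ 2 (mod 9)`, case (2) with `d < 0`; (3a) `h₃(−7) = 1`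
(`threeClassNumberTrivial_neg7`). [cite: KrizLi2019, Thm. 1.23 = Thm. 10.10 and Cor. 10.7 (2)]
[cite: Cremona1997, Table 1 (class 1323m)] -/
theorem bsdp_three_cremona1323m_of_family
    (h : thm1010_bsdThree_overK_sexticTwist) (h107 : cor107_analyticRank_sexticTwist)
    (h94 : thm94_exists_heegnerField_h3_eq_one)
    (hGZ : ∀ (N : ℕ) [NeZero N] (W : WeierstrassCurve ℚ) (K : Type) [Field K] [NumberField K],
      gross_zagier N W K)
    (hKo : ∀ (N : ℕ) [NeZero N] (W : WeierstrassCurve ℚ) (K : Type) [Field K] [NumberField K],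
      kolyvagin N W K)
    (hrat : ∀ (N : ℕ) [NeZero N] (W : WeierstrassCurve ℚ) (K : Type) [Field K] [NumberField K],
      heegnerPointComplex_mem_range_map N W K)
    (hCM0 : bsdTriple_of_hasCM_of_L_one_ne_zero) (hmod : hasEntireLFunction_rat)
    (hCassels : bsdRHS_eq_of_isIsogenous)
    (hDt : ∃ Dt : ModularParametrizationData cremona1323m2 1323, ¬ (3 : ℤ) ∣ Dt.c)
    (hN : cremona1323m2.conductorNorm ℤ = 1323) :
    (BSDp cremona1323m2 3 ∧ cremona1323m2.ShaFinite ∧ cremona1323m2.analyticRank = 1 ∧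
        cremona1323m2.mordellWeilRank = 1) ∧
      (BSDp cremona1323m1 3 ∧ cremona1323m1.analyticRank = 1) := by
  haveI : NeZero (1323 : ℕ) := ⟨by norm_num⟩
  refine record_of_family h h107 h94 hGZ hKo hrat hCM0 hmod hCassels (-7) cremona1323m2 1323
    cremona1323m2_eq hN ?_ (by norm_num) ?_ (by norm_num) hDt cremona1323m1 isIsogenous_cremona1323m
  · exact Or.inl ⟨by norm_num, by simpa using squarefree_neg_natCast (by norm_num : Nat.Prime 7).squarefree,
      by norm_num⟩
  · exact ⟨fun h => absurd h (by norm_num), fun _ => threeClassNumberTrivial_neg7⟩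

/-- **`1728a` (`d = 8`)**: `1728a2 = [0,0,0,0,−54] ≅ E_8 : y² = x³ − 3456` (`u = 1/2`),
`1728a1 ~ 1728a2`. Per-pair inputs `hDt`, `hN : N(1728a2) = 1728`. `8 ≡ 8 (mod 9)`, `d > 0`; (1)
`8 = 4·2`, `2 ≡ 2 (mod 4)`; (3a) `h₃(−24) = 1` (`h(−24) = 2`, `threeClassNumberTrivial_neg24`). (The
class has two further members 1728a3/a4 of `j ≠ 0`; `BSD(·,3)` reaches them by Cassels through
`bsdp_three_of_isIsogenous_sexticTwist_family` once their isogeny to 1728a2 is supplied.)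
[cite: KrizLi2019, Thm. 1.23 = Thm. 10.10 and Cor. 10.7 (2)] [cite: Cremona1997, Table 1 (class 1728a)] -/
theorem bsdp_three_cremona1728a_of_family
    (h : thm1010_bsdThree_overK_sexticTwist) (h107 : cor107_analyticRank_sexticTwist)
    (h94 : thm94_exists_heegnerField_h3_eq_one)
    (hGZ : ∀ (N : ℕ) [NeZero N] (W : WeierstrassCurve ℚ) (K : Type) [Field K] [NumberField K],
      gross_zagier N W K)
    (hKo : ∀ (N : ℕ) [NeZero N] (W : WeierstrassCurve ℚ) (K : Type) [Field K] [NumberField K],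
      kolyvagin N W K)
    (hrat : ∀ (N : ℕ) [NeZero N] (W : WeierstrassCurve ℚ) (K : Type) [Field K] [NumberField K],
      heegnerPointComplex_mem_range_map N W K)
    (hCM0 : bsdTriple_of_hasCM_of_L_one_ne_zero) (hmod : hasEntireLFunction_rat)
    (hCassels : bsdRHS_eq_of_isIsogenous)
    (hDt : ∃ Dt : ModularParametrizationData cremona1728a2 1728, ¬ (3 : ℤ) ∣ Dt.c)
    (hN : cremona1728a2.conductorNorm ℤ = 1728) :
    (BSDp cremona1728a2 3 ∧ cremona1728a2.ShaFinite ∧ cremona1728a2.analyticRank = 1 ∧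
        cremona1728a2.mordellWeilRank = 1) ∧
      (BSDp cremona1728a1 3 ∧ cremona1728a1.analyticRank = 1) := by
  haveI : NeZero (1728 : ℕ) := ⟨by norm_num⟩
  refine record_of_family h h107 h94 hGZ hKo hrat hCM0 hmod hCassels 8 cremona1728a2 1728
    cremona1728a2_eq hN ?_ (by norm_num) ?_ (by norm_num) hDt cremona1728a1 isIsogenous_cremona1728a
  · refine Or.inr ⟨by norm_num, by norm_num, ?_⟩
    rw [show ((8 : ℤ) / 4) = 2 by norm_num]
    exact squarefree_intCast_of_prime Nat.prime_two
  · exact ⟨fun _ => by norm_num; exact threeClassNumberTrivial_neg24, fun h => absurd h (by norm_num)⟩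

/-- **`3888t` (`d = 12`)**: `3888t2 = [0,0,0,0,−81] ≅ E_{12} : y² = x³ − 5184` (`u = 1/2`),
`3888t1 ~ 3888t2`. Per-pair inputs `hDt`, `hN : N(3888t2) = 3888`. `12 ≡ 3 (mod 9)`, `d > 0`; (1)
`12 = 4·3`, `3 ≡ 3 (mod 4)`; (3a) `h₃(−36) = 1` (the field is `ℚ(i)`, `threeClassNumberTrivial_neg36`).
[cite: KrizLi2019, Thm. 1.23 = Thm. 10.10 and Cor. 10.7 (2)] [cite: Cremona1997, Table 1 (class 3888t)] -/
theorem bsdp_three_cremona3888t_of_family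
    (h : thm1010_bsdThree_overK_sexticTwist) (h107 : cor107_analyticRank_sexticTwist)
    (h94 : thm94_exists_heegnerField_h3_eq_one)
    (hGZ : ∀ (N : ℕ) [NeZero N] (W : WeierstrassCurve ℚ) (K : Type) [Field K] [NumberField K],
      gross_zagier N W K)
    (hKo : ∀ (N : ℕ) [NeZero N] (W : WeierstrassCurve ℚ) (K : Type) [Field K] [NumberField K],
      kolyvagin N W K)
    (hrat : ∀ (N : ℕ) [NeZero N] (W : WeierstrassCurve ℚ) (K : Type) [Field K] [NumberField K],
      heegnerPointComplex_mem_range_map N W K)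
    (hCM0 : bsdTriple_of_hasCM_of_L_one_ne_zero) (hmod : hasEntireLFunction_rat)
    (hCassels : bsdRHS_eq_of_isIsogenous)
    (hDt : ∃ Dt : ModularParametrizationData cremona3888t2 3888, ¬ (3 : ℤ) ∣ Dt.c)
    (hN : cremona3888t2.conductorNorm ℤ = 3888) :
    (BSDp cremona3888t2 3 ∧ cremona3888t2.ShaFinite ∧ cremona3888t2.analyticRank = 1 ∧
        cremona3888t2.mordellWeilRank = 1) ∧
      (BSDp cremona3888t1 3 ∧ cremona3888t1.analyticRank = 1) := by
  haveI : NeZero (3888 : ℕ) := ⟨by norm_num⟩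
  refine record_of_family h h107 h94 hGZ hKo hrat hCM0 hmod hCassels 12 cremona3888t2 3888
    cremona3888t2_eq hN ?_ (by norm_num) ?_ (by norm_num) hDt cremona3888t1 isIsogenous_cremona3888t
  · refine Or.inr ⟨by norm_num, by norm_num, ?_⟩
    rw [show ((12 : ℤ) / 4) = 3 by norm_num]
    exact squarefree_intCast_of_prime Nat.prime_three
  · exact ⟨fun _ => by norm_num; exact threeClassNumberTrivial_neg36, fun h => absurd h (by norm_num)⟩

/-- **`7803b` (`d = 17`)**: `7803b2 = [0,0,1,0,−115] ≅ E_{17} : y² = x³ − 7344`, `7803b1 ~ 7803b2`.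
Per-pair inputs `hDt`, `hN : N(7803b2) = 7803`. `17 ≡ 8 (mod 9)`, `d > 0`; (1) `17 ≡ 1 (mod 4)`
prime; (3a) `h₃(−51) = 1` (`h(−51) = 2`, `threeClassNumberTrivial_neg51`).
[cite: KrizLi2019, Thm. 1.23 = Thm. 10.10 and Cor. 10.7 (2)] [cite: Cremona1997, Table 1 (class 7803b)] -/
theorem bsdp_three_cremona7803b_of_family
    (h : thm1010_bsdThree_overK_sexticTwist) (h107 : cor107_analyticRank_sexticTwist)
    (h94 : thm94_exists_heegnerField_h3_eq_one)
    (hGZ : ∀ (N : ℕ) [NeZero N] (W : WeierstrassCurve ℚ) (K : Type) [Field K] [NumberField K],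
      gross_zagier N W K)
    (hKo : ∀ (N : ℕ) [NeZero N] (W : WeierstrassCurve ℚ) (K : Type) [Field K] [NumberField K],
      kolyvagin N W K)
    (hrat : ∀ (N : ℕ) [NeZero N] (W : WeierstrassCurve ℚ) (K : Type) [Field K] [NumberField K],
      heegnerPointComplex_mem_range_map N W K)
    (hCM0 : bsdTriple_of_hasCM_of_L_one_ne_zero) (hmod : hasEntireLFunction_rat)
    (hCassels : bsdRHS_eq_of_isIsogenous)
    (hDt : ∃ Dt : ModularParametrizationData cremona7803b2 7803, ¬ (3 : ℤ) ∣ Dt.c)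
    (hN : cremona7803b2.conductorNorm ℤ = 7803) :
    (BSDp cremona7803b2 3 ∧ cremona7803b2.ShaFinite ∧ cremona7803b2.analyticRank = 1 ∧
        cremona7803b2.mordellWeilRank = 1) ∧
      (BSDp cremona7803b1 3 ∧ cremona7803b1.analyticRank = 1) := by
  haveI : NeZero (7803 : ℕ) := ⟨by norm_num⟩
  refine record_of_family h h107 h94 hGZ hKo hrat hCM0 hmod hCassels 17 cremona7803b2 7803
    cremona7803b2_eq hN ?_ (by norm_num) ?_ (by norm_num) hDt cremona7803b1 isIsogenous_cremona7803b
  · exact Or.inl ⟨by norm_num, squarefree_intCast_of_prime (by norm_num : Nat.Prime 17), by norm_num⟩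
  · exact ⟨fun _ => by norm_num; exact threeClassNumberTrivial_neg51, fun h => absurd h (by norm_num)⟩

/-- **`11907s` (`d = 21`)**: `11907s2 = [0,0,1,0,−142] ≅ E_{21} : y² = x³ − 9072`,
`11907s1 ~ 11907s2`. Per-pair inputs `hDt`, `hN : N(11907s2) = 11907`. `21 ≡ 3 (mod 9)`, `d > 0`;
(1) `21 = 3·7 ≡ 1 (mod 4)`; (3a) `h₃(−63) = 1` (the field is `ℚ(√−7)`, `threeClassNumberTrivial_neg63`).
[cite: KrizLi2019, Thm. 1.23 = Thm. 10.10 and Cor. 10.7 (2)] [cite: Cremona1997, Table 1 (class 11907s)] -/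
theorem bsdp_three_cremona11907s_of_family
    (h : thm1010_bsdThree_overK_sexticTwist) (h107 : cor107_analyticRank_sexticTwist)
    (h94 : thm94_exists_heegnerField_h3_eq_one)
    (hGZ : ∀ (N : ℕ) [NeZero N] (W : WeierstrassCurve ℚ) (K : Type) [Field K] [NumberField K],
      gross_zagier N W K)
    (hKo : ∀ (N : ℕ) [NeZero N] (W : WeierstrassCurve ℚ) (K : Type) [Field K] [NumberField K],
      kolyvagin N W K)
    (hrat : ∀ (N : ℕ) [NeZero N] (W : WeierstrassCurve ℚ) (K : Type) [Field K] [NumberField K],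
      heegnerPointComplex_mem_range_map N W K)
    (hCM0 : bsdTriple_of_hasCM_of_L_one_ne_zero) (hmod : hasEntireLFunction_rat)
    (hCassels : bsdRHS_eq_of_isIsogenous)
    (hDt : ∃ Dt : ModularParametrizationData cremona11907s2 11907, ¬ (3 : ℤ) ∣ Dt.c)
    (hN : cremona11907s2.conductorNorm ℤ = 11907) :
    (BSDp cremona11907s2 3 ∧ cremona11907s2.ShaFinite ∧ cremona11907s2.analyticRank = 1 ∧
        cremona11907s2.mordellWeilRank = 1) ∧
      (BSDp cremona11907s1 3 ∧ cremona11907s1.analyticRank = 1) := by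
  haveI : NeZero (11907 : ℕ) := ⟨by norm_num⟩
  refine record_of_family h h107 h94 hGZ hKo hrat hCM0 hmod hCassels 21 cremona11907s2 11907
    cremona11907s2_eq hN ?_ (by norm_num) ?_ (by norm_num) hDt cremona11907s1
    isIsogenous_cremona11907s
  · refine Or.inl ⟨by norm_num, ?_, by norm_num⟩
    have h21 : Squarefree ((3 * 7 : ℕ) : ℤ) :=
      Int.squarefree_natCast.mpr (squarefree_mul_of_prime Nat.prime_three (by norm_num) (by decide))
    simpa using h21
  · exact ⟨fun _ => by norm_num; exact threeClassNumberTrivial_neg63, fun h => absurd h (by norm_num)⟩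

/-- **`15129a` (`d = 41`)**: `15129a2 = [0,0,1,0,−277] ≅ E_{41} : y² = x³ − 17712`,
`15129a1 ~ 15129a2`. Per-pair inputs `hDt`, `hN : N(15129a2) = 15129`. `41 ≡ 5 (mod 9)`, `d > 0`;
(1) `41 ≡ 1 (mod 4)` prime; (3a) `h₃(−123) = 1` (`h(−123) = 2`, `threeClassNumberTrivial_neg123`).
[cite: KrizLi2019, Thm. 1.23 = Thm. 10.10 and Cor. 10.7 (2)] [cite: Cremona1997, Table 1 (class 15129a)] -/
theorem bsdp_three_cremona15129a_of_family
    (h : thm1010_bsdThree_overK_sexticTwist) (h107 : cor107_analyticRank_sexticTwist)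
    (h94 : thm94_exists_heegnerField_h3_eq_one)
    (hGZ : ∀ (N : ℕ) [NeZero N] (W : WeierstrassCurve ℚ) (K : Type) [Field K] [NumberField K],
      gross_zagier N W K)
    (hKo : ∀ (N : ℕ) [NeZero N] (W : WeierstrassCurve ℚ) (K : Type) [Field K] [NumberField K],
      kolyvagin N W K)
    (hrat : ∀ (N : ℕ) [NeZero N] (W : WeierstrassCurve ℚ) (K : Type) [Field K] [NumberField K],
      heegnerPointComplex_mem_range_map N W K)
    (hCM0 : bsdTriple_of_hasCM_of_L_one_ne_zero) (hmod : hasEntireLFunction_rat)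
    (hCassels : bsdRHS_eq_of_isIsogenous)
    (hDt : ∃ Dt : ModularParametrizationData cremona15129a2 15129, ¬ (3 : ℤ) ∣ Dt.c)
    (hN : cremona15129a2.conductorNorm ℤ = 15129) :
    (BSDp cremona15129a2 3 ∧ cremona15129a2.ShaFinite ∧ cremona15129a2.analyticRank = 1 ∧
        cremona15129a2.mordellWeilRank = 1) ∧
      (BSDp cremona15129a1 3 ∧ cremona15129a1.analyticRank = 1) := by
  haveI : NeZero (15129 : ℕ) := ⟨by norm_num⟩
  refine record_of_family h h107 h94 hGZ hKo hrat hCM0 hmod hCassels 41 cremona15129a2 15129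
    cremona15129a2_eq hN ?_ (by norm_num) ?_ (by norm_num) hDt cremona15129a1
    isIsogenous_cremona15129a
  · exact Or.inl ⟨by norm_num, squarefree_intCast_of_prime (by norm_num : Nat.Prime 41), by norm_num⟩
  · exact ⟨fun _ => by norm_num; exact threeClassNumberTrivial_neg123, fun h => absurd h (by norm_num)⟩

end Summit.BirchSwinnertonDyer.Rank1Residual.X12.SexticTwistFamily

end
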